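import Summits.ResolutionOfSingularities.ResolutionOfSingularities.Theorems.HilbertSamuelEliminationSigmaMaxModificationsCorridor3SigmaMenuNonempty
import Summits.ResolutionOfSingularities.ResolutionOfSingularities.Theorems.HilbertSamuelEliminationSigmaMaxModificationsCorridor3RegularCentresPermissible
import HarnessLib

/-!
# [OURS · L1 W4.2] σ-LAYER — `Corridor3SigmaMenuStratum`: the WIDEST menu — `stratumMenu` (regular centre through the point, inside `X(ν)`) —
# its clause (a) on good scopes, the weaker discipline type `StrategyE.IsStratumDisciplined`, the monotonicity `IsMenuDisciplined → IsStratumDisciplined`,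
# and the admissibility plugs `_stratum` (res-L1-w42-plan-1 RULING v3.14-32 (HF) «FIX OF RECORD = WIDEN THE MENU, NOT THE DESIGN»: the (P1*) prep
# centres — regular curves in `Sing D` of a singular surface component of `X(ν)` — are not Plus-menu members; E7 uses discipline ONLY through clause (a))
# (crux chain w42 `SigmaMaxModifications` stmt-ResolutionOfSingularities-18506 / conjunct `SigmaMaxModificationsCorridor3` stmt-ResolutionOfSingularities-19249;
# typer res-L1-type-o1 (OURS typer G4); `--supports stmt-…-19249 --as helper`, counted 0)

HONEST FRAMING. OURS bookkeeping over this typer's `…SigmaMenuDiscipline` (p526241: `CentreMenu`, `IsDisciplinedBy[Over]`, `MenuClauseA`,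
`isAdmissibleStrategyOnE_of_disciplinedBy[Over]`, `isAdmissibleStrategyOnE_hybrid`), `…SigmaMenuStrategy` (p527045: `plusMenu`, `StateScopeGood`,
`IsMenuDisciplined`), `…SigmaMenuNonempty` (p528086) and the cell's `…Corridor3RegularCentresPermissible`
(`isPermissible_of_isRegular_subscheme_of_support_subset_hsStratum_of_isExcellent`, CJS Thm. 3.3 packaged). NOTHING here is a statement of H. Hironaka's
manuscript [Hironaka2017] nor of Cossart–Jannsen–Saito [CossartJannsenSaito2020]; no named fact is introduced; AI-typed, AI review is weaker than expert review.

## Contents (namespace `…Theorems.SigmaMaxModificationsCorridor3.Sigma`)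

* **`stratumMenu : CentreMenu`** — `C.subscheme` REGULAR ∧ `x ∈ V(C)` ∧ (`X(ν)` closed → `x ∈ X(ν)` → `V(C) ⊆ X(ν)`). The inclusion clause is stated
  CONDITIONALLY on «`X(ν)` closed, `x ∈ X(ν)`» — both hold wherever the menu is read (discipline supplies `x ∈ X(ν)`; good scopes supply closedness),
  and the conditional form is what makes `plusMenu_le_stratumMenu` and `IsMenuDisciplined.toStratum` UNCONDITIONAL implications (a Plus-menu member lies
  in `X(ν)` only because `X(ν)` is closed: `plusMenu.support_subset_hsStratum`). Accessor `stratumMenu.support_subset_hsStratum`.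
* `basicMenu_le_stratumMenu`, **`plusMenu_le_stratumMenu`**; **`menuClauseA_stratum`** `: StateScopeGood N ν 𝒮 → ν ≠ Φ^{(N)} → MenuClauseA stratumMenu N ν 𝒮`
  (permissible BY NAME from `isPermissible_of_isRegular_subscheme_of_support_subset_hsStratum_of_isExcellent`; verbatim the shape of `menuClauseA_plus`).
* **`StrategyE.IsStratumDisciplined N ν σ := σ.IsDisciplinedBy stratumMenu N ν`**, `StrategyE.IsStratumDisciplinedOver N ν τ σ`,
  **`IsMenuDisciplined.toStratum`**, `IsMenuDisciplinedOver.toStratum`, `IsStratumDisciplined.hybrid`, `IsStratumDisciplined.stepsOnlyWhileNonempty[_hybrid]`.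
* The plugs, suffix `_stratum`: `isAdmissibleStrategyOnE_of_stratumDisciplined`, `isAdmissibleStrategyOnE_of_stratumDisciplinedOver`,
  **`isAdmissibleStrategyOnE_hybrid_stratum`** (ANY stratum-disciplined policy over a fallback with clause (a) + totality on a good scope is admissible).

VACUITY SELF-CHECK. Definitions + one-line consequences; `stratumMenu` is strictly wider than `plusMenu` (the cusp-edge specimen of RULING -32: a regular
curve `Γ ⊂ Sing D`, `D = {y² = x³} × 𝔸¹ = X(ν)`, is a stratum-menu centre at its points and not a Plus-menu member), so `IsStratumDisciplined` is a weaker,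
non-vacuous type; clause (a) is CJS Thm. 3.3, not a tautology.
-/

noncomputable section

set_option linter.dupNamespace false -- mandated namespace of this single-conjunct summit

open CategoryTheory AlgebraicGeometry TopologicalSpace
open Summit.ResolutionOfSingularities.ResolutionOfSingularities.Theorems.CampaignW42
open Literature.AlgebraicGeometry.Resolution Literature.RingTheory.HilbertSamuel
open Summit.ResolutionOfSingularities.ResolutionOfSingularities.Theorems.SigmaMaxModificationsCorridor3.Helpers
  (isPermissible_of_isRegular_subscheme_of_support_subset_hsStratum_of_isExcellent)

namespace Summit.ResolutionOfSingularities.ResolutionOfSingularities.Theorems.SigmaMaxModificationsCorridor3.Sigma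

universe u

/-! ## §1. The stratum menu -/

/-- [OURS · L1 W4.2] **THE STRATUM MENU — the widest centre menu of the σ-layer** (RULING v3.14-32 (HF)): `C` is an allowed centre at `x` iff `C.subscheme`
is REGULAR, `x ∈ V(C)`, and — `X(ν)` being closed and containing `x`, as wherever the menu is read — `V(C) ⊆ X(ν)`. Hosts the Plus menu AND the (P1*)
prep centres (regular curves in the singular locus of a surface component of `X(ν)`), the B′ point steps, the surface faces. NOT a statement of the
manuscript. [folklore] -/
def stratumMenu : CentreMenu.{u} :=
  fun W _ N ν x C => Scheme.IsRegular C.subscheme ∧ x ∈ (C.support : Set W) ∧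
    (IsClosed (Scheme.hsStratum W N ν) → x ∈ Scheme.hsStratum W N ν → (C.support : Set W) ⊆ Scheme.hsStratum W N ν)

section Menu

variable {W : Scheme.{u}} {E : Boundary W} {N : ℕ} {ν : ℕ → ℕ} {x : W} {C : W.IdealSheafData}

/-- Unfolding (`Iff.rfl`). [folklore] -/
theorem stratumMenu_iff : stratumMenu W E N ν x C ↔ Scheme.IsRegular C.subscheme ∧ x ∈ (C.support : Set W) ∧
    (IsClosed (Scheme.hsStratum W N ν) → x ∈ Scheme.hsStratum W N ν → (C.support : Set W) ⊆ Scheme.hsStratum W N ν) :=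
  Iff.rfl

/-- Constructor from the UNCONDITIONAL inclusion (how a constructed policy proves stratum discipline). [folklore] -/
theorem stratumMenu_of_subset (hreg : Scheme.IsRegular C.subscheme) (hx : x ∈ (C.support : Set W))
    (hsub : (C.support : Set W) ⊆ Scheme.hsStratum W N ν) : stratumMenu W E N ν x C :=
  ⟨hreg, hx, fun _ _ => hsub⟩

/-- A stratum-menu centre is regular. [folklore] -/
theorem stratumMenu.isRegular (h : stratumMenu W E N ν x C) : Scheme.IsRegular C.subscheme :=
  h.1

/-- A stratum-menu centre passes through its point. [folklore] -/
theorem stratumMenu.mem_support (h : stratumMenu W E N ν x C) : x ∈ (C.support : Set W) :=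
  h.2.1

/-- A stratum-menu centre lies in the `ν`-stratum (`X(ν)` closed, `x ∈ X(ν)`). [folklore] -/
theorem stratumMenu.support_subset_hsStratum (h : stratumMenu W E N ν x C) (hY : IsClosed (Scheme.hsStratum W N ν))
    (hx : x ∈ Scheme.hsStratum W N ν) : (C.support : Set W) ⊆ Scheme.hsStratum W N ν :=
  h.2.2 hY hx

/-- **The Plus menu is contained in the stratum menu.** [folklore] -/
theorem plusMenu_le_stratumMenu (h : plusMenu W E N ν x C) : stratumMenu W E N ν x C :=
  ⟨h.2, plusMenu.mem_support h, fun hY hx => plusMenu.support_subset_hsStratum h hY hx⟩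

/-- The basic menu is contained in the stratum menu. [folklore] -/
theorem basicMenu_le_stratumMenu (h : basicMenu W E N ν x C) : stratumMenu W E N ν x C :=
  plusMenu_le_stratumMenu (basicMenu_le_plusMenu h)

/-- **A stratum-menu centre is PERMISSIBLE** on a reduced excellent stage of dimension `≤ N` with closed `ν`-stratum through `x`, `ν ≠ Φ^{(N)}` — BY NAME
from the cell's `isPermissible_of_isRegular_subscheme_of_support_subset_hsStratum_of_isExcellent` (CJS Thm. 3.3 packaged).
[cite: CossartJannsenSaito2020, Def. 3.1 (2), Thm. 3.3] -/
theorem stratumMenu.isPermissible [IsLocallyNoetherian W] [IsReduced W] (hexc : Scheme.IsExcellent W)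
    (hdim : topologicalKrullDim W ≤ (N : WithBot ℕ∞)) (hν : ν ≠ iterPSum N Phi) (hY : IsClosed (Scheme.hsStratum W N ν))
    (hx : x ∈ Scheme.hsStratum W N ν) (h : stratumMenu W E N ν x C) : IdealSheafData.IsPermissible C :=
  isPermissible_of_isRegular_subscheme_of_support_subset_hsStratum_of_isExcellent hexc hdim hν C h.isRegular
    (h.support_subset_hsStratum hY hx)

end Menu

section ClauseA

variable {N : ℕ} {ν : ℕ → ℕ} {𝒮 : StateScopeE.{u}}

/-- **THE STRATUM MENU SATISFIES CLAUSE (a) ON GOOD SCOPES** (`ν ≠ Φ^{(N)}`): permissible, inside `X(ν)`, non-empty (it contains its point) — verbatim the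
shape of `menuClauseA_plus`. [cite: CossartJannsenSaito2020, Def. 3.1, Thm. 3.3] -/
theorem menuClauseA_stratum (h𝒮 : StateScopeGood N ν 𝒮) (hν : ν ≠ iterPSum N Phi) : MenuClauseA stratumMenu N ν 𝒮 := by
  intro W hW L P E hS x hx C hC
  haveI : IsLocallyNoetherian W := hW
  obtain ⟨hred, hexc, hdim, hY⟩ := h𝒮 W hW L P E hS
  haveI : IsReduced W := hred
  exact ⟨stratumMenu.isPermissible hexc hdim hν hY hx hC, hC.support_subset_hsStratum hY hx, fun _ => ⟨x, hC.mem_support⟩⟩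

end ClauseA

/-! ## §2. Stratum discipline: the weakest discipline type, and its plugs -/

/-- [OURS · L1 W4.2] **STRATUM-DISCIPLINED**: every step has as centre a REGULAR subscheme through a point of the `ν`-stratum, inside the stratum (the
type the CORE stub is henceforth closed through, RULING v3.14-32 (HF) (2): `HybridEliminationHyp3S`). [folklore] -/
def StrategyE.IsStratumDisciplined (N : ℕ) (ν : ℕ → ℕ) (σ : StrategyE.{u}) : Prop :=
  σ.IsDisciplinedBy stratumMenu N ν

/-- [OURS · L1 W4.2] **STRATUM-DISCIPLINED OVER A FALLBACK** (hybrid shape). [folklore] -/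
def StrategyE.IsStratumDisciplinedOver (N : ℕ) (ν : ℕ → ℕ) (τ σ : StrategyE.{u}) : Prop :=
  StrategyE.IsDisciplinedByOver stratumMenu N ν τ σ

section Discipline

variable {N : ℕ} {ν : ℕ → ℕ} {𝒮 : StateScopeE.{u}} {π τ σ : StrategyE.{u}}

/-- Unfolding (`Iff.rfl`). [folklore] -/
theorem StrategyE.isStratumDisciplined_iff : σ.IsStratumDisciplined N ν ↔ σ.IsDisciplinedBy stratumMenu N ν :=
  Iff.rfl

/-- **MENU discipline implies STRATUM discipline** (Plus ⊆ stratum menu). [folklore] -/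
theorem StrategyE.IsMenuDisciplined.toStratum (h : σ.IsMenuDisciplined N ν) : σ.IsStratumDisciplined N ν :=
  StrategyE.IsDisciplinedBy.mono h fun _ _ _ _ hC => plusMenu_le_stratumMenu hC

/-- … and the same over a fallback. [folklore] -/
theorem StrategyE.IsMenuDisciplinedOver.toStratum (h : StrategyE.IsMenuDisciplinedOver N ν τ σ) : StrategyE.IsStratumDisciplinedOver N ν τ σ :=
  fun W hW L P E C P' hstep => (h W hW L P E C P' hstep).imp (fun ⟨x, hx, hC⟩ => ⟨x, hx, plusMenu_le_stratumMenu hC⟩) id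

/-- Basic-menu discipline implies stratum discipline. [folklore] -/
theorem StrategyE.IsDisciplinedBy.basic_to_stratum (h : σ.IsDisciplinedBy basicMenu N ν) : σ.IsStratumDisciplined N ν :=
  h.basic_to_plus.toStratum

/-- The hybrid of a stratum-disciplined policy is stratum-disciplined over its fallback. [folklore] -/
theorem StrategyE.IsStratumDisciplined.hybrid (h : π.IsStratumDisciplined N ν) (τ : StrategyE.{u}) :
    StrategyE.IsStratumDisciplinedOver N ν τ (π.hybrid τ) :=
  StrategyE.IsDisciplinedBy.hybrid h τ

/-- A stratum-disciplined strategy steps only while the stratum is non-empty. [folklore] -/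
theorem StrategyE.IsStratumDisciplined.stepsOnlyWhileNonempty (h : σ.IsStratumDisciplined N ν) : σ.StepsOnlyWhileNonempty N ν :=
  StrategyE.IsDisciplinedBy.stepsOnlyWhileNonempty h

/-- … and so does its hybrid over a fallback with that property. [folklore] -/
theorem StrategyE.IsStratumDisciplined.stepsOnlyWhileNonempty_hybrid (hπ : π.IsStratumDisciplined N ν) (hτ : τ.StepsOnlyWhileNonempty N ν) :
    (π.hybrid τ).StepsOnlyWhileNonempty N ν :=
  StrategyE.IsDisciplinedBy.stepsOnlyWhileNonempty_hybrid hπ hτ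

/-- … and for the fallback of record `ofStageOracleE ω`. [folklore] -/
theorem StrategyE.IsStratumDisciplined.stepsOnlyWhileNonempty_hybrid_ofStageOracleE (hπ : π.IsStratumDisciplined N ν) (ω : StageOracleE.{u}) :
    (π.hybrid (StrategyE.ofStageOracleE ω)).StepsOnlyWhileNonempty N ν :=
  hπ.stepsOnlyWhileNonempty_hybrid (StrategyE.stepsOnlyWhileNonempty_ofStageOracleE ω N ν)

/-- **A stratum-disciplined strategy, total on a good scope, is admissible there** (`ν ≠ Φ^{(N)}`). [cite: CossartJannsenSaito2020, Def. 3.1, Rem. 6.29 (1)] -/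
theorem isAdmissibleStrategyOnE_of_stratumDisciplined (hσ : σ.IsStratumDisciplined N ν) (h𝒮 : StateScopeGood N ν 𝒮) (hν : ν ≠ iterPSum N Phi)
    (htotal : ∀ (W : Scheme.{u}) (hW : IsLocallyNoetherian W) (L : Labelling W) (P : Option (Pending W)) (E : Boundary W), 𝒮 W hW L P E →
      (Scheme.hsStratum W N ν).Nonempty → ∃ (C : W.IdealSheafData) (P' : Option (Pending (blowup C))), σ.step W hW N ν L P E C P') :
    IsAdmissibleStrategyOnE 𝒮 N ν σ :=
  isAdmissibleStrategyOnE_of_disciplinedBy hσ (menuClauseA_stratum h𝒮 hν) htotal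

/-- **A hybrid, stratum-disciplined over a fallback with admissible steps, total on a good scope, is admissible there** (`ν ≠ Φ^{(N)}`).
[cite: CossartJannsenSaito2020, Def. 3.1, Rem. 6.29 (1)] -/
theorem isAdmissibleStrategyOnE_of_stratumDisciplinedOver (hσ : StrategyE.IsStratumDisciplinedOver N ν τ σ) (h𝒮 : StateScopeGood N ν 𝒮)
    (hν : ν ≠ iterPSum N Phi)
    (hτ : ∀ (W : Scheme.{u}) (hW : IsLocallyNoetherian W) (L : Labelling W) (P : Option (Pending W)) (E : Boundary W), 𝒮 W hW L P E →
      ∀ (C : W.IdealSheafData) (P' : Option (Pending (blowup C))), τ.step W hW N ν L P E C P' →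
        IdealSheafData.IsPermissible C ∧ (C.support : Set W) ⊆ Scheme.hsStratum W N ν ∧
          ((Scheme.hsStratum W N ν).Nonempty → (C.support : Set W).Nonempty))
    (htotal : ∀ (W : Scheme.{u}) (hW : IsLocallyNoetherian W) (L : Labelling W) (P : Option (Pending W)) (E : Boundary W), 𝒮 W hW L P E →
      (Scheme.hsStratum W N ν).Nonempty → ∃ (C : W.IdealSheafData) (P' : Option (Pending (blowup C))), σ.step W hW N ν L P E C P') :
    IsAdmissibleStrategyOnE 𝒮 N ν σ :=
  isAdmissibleStrategyOnE_of_disciplinedByOver hσ (menuClauseA_stratum h𝒮 hν) hτ htotal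

/-- **THE WIDEST PLUG**: the hybrid `π.hybrid τ` of ANY stratum-disciplined policy `π` over a fallback `τ` whose steps satisfy clause (a) and which is TOTAL
on a good scope, is ADMISSIBLE on that scope (`ν ≠ Φ^{(N)}`). [cite: CossartJannsenSaito2020, Def. 3.1, Rem. 6.29 (1)] -/
theorem isAdmissibleStrategyOnE_hybrid_stratum (hπ : π.IsStratumDisciplined N ν) (h𝒮 : StateScopeGood N ν 𝒮) (hν : ν ≠ iterPSum N Phi)
    (hτa : ∀ (W : Scheme.{u}) (hW : IsLocallyNoetherian W) (L : Labelling W) (P : Option (Pending W)) (E : Boundary W), 𝒮 W hW L P E →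
      ∀ (C : W.IdealSheafData) (P' : Option (Pending (blowup C))), τ.step W hW N ν L P E C P' →
        IdealSheafData.IsPermissible C ∧ (C.support : Set W) ⊆ Scheme.hsStratum W N ν ∧
          ((Scheme.hsStratum W N ν).Nonempty → (C.support : Set W).Nonempty))
    (hτt : ∀ (W : Scheme.{u}) (hW : IsLocallyNoetherian W) (L : Labelling W) (P : Option (Pending W)) (E : Boundary W), 𝒮 W hW L P E →
      (Scheme.hsStratum W N ν).Nonempty → ∃ (C : W.IdealSheafData) (P' : Option (Pending (blowup C))), τ.step W hW N ν L P E C P') :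
    IsAdmissibleStrategyOnE 𝒮 N ν (π.hybrid τ) :=
  isAdmissibleStrategyOnE_hybrid hπ (menuClauseA_stratum h𝒮 hν) hτa hτt

end Discipline

end Summit.ResolutionOfSingularities.ResolutionOfSingularities.Theorems.SigmaMaxModificationsCorridor3.Sigma

end
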